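import Mathlib
import HarnessLib
import Literature.MathematicalPhysics.QuantumFieldTheory.ConstructiveQFTWave0
import Summits.Ventures.LatticeQCDFlow.Scaling.LatticeEntropyU1
import Summits.Ventures.LatticeQCDFlow.Scaling.LatticeEntropySUNHaar

/-!
# LatticeQCDFlow / Scaling — two-sided Haar volumes of metric balls in `U(1) = Circle` (v2.5)

HONEST FRAMING: exact (Metropolis-corrected) sampling algorithms for lattice gauge theory; figures
of merit are autocorrelation/cost numbers at stated couplings and volumes; no continuum-physics
claim.

Venture `LatticeQCDFlow` (cell pub-lqcd), topic `Scaling`, FANOUT row 29 (theory2) — OUR WORK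
(THEORY-2.md v2.5 §3.3, row C2a).  The group-specific input of the transport-rigidity theorem
(C2a)/(C2a-R) (`Scaling/ExactTransportVolume.lean`) for the `Circle` model, in the exact shape of
row 30's hypotheses `hlo`, `hup` (metric balls `closedBall g r` about an ARBITRARY centre, for the
chordal metric `Circle` carries as a subtype of `ℂ`; Ahlfors exponent `κ = 1`):
`(1/π)·r ≤ Haar(B̄(g, r))` for `0 < r ≤ 1` (`haar_closedBall_ge`) and `Haar(B̄(g, r)) ≤ r/2` for
`0 < r` (`haar_closedBall_le`), packaged as `haar_closedBall_ge'`, `haar_closedBall_le'`.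
This file only ASSEMBLES: the centre-`1` estimates are row 30's — the arc
`arc ε = exp(i[−ε, ε])` with `haar_arc_ge` (`Scaling/LatticeEntropyU1.lean`) and, from
`Scaling/LatticeEntropySUNHaar.lean`, `SUNHaar.norm_sub_one_le_of_mem_arc` (`arc r ⊆ B̄(1, r)`)
and `SUNHaar.haar_chordBall_le` (`Haar{|z − 1| ≤ t} ≤ t/2`, `t < 2`); new here are the
identification of the metric ball with the chordal ball (`dist_eq_norm_coe`,
`closedBall_one_eq`), translation invariance (`closedBall_eq_preimage`, `haar_closedBall_eq`),
the trivial bound `Haar ≤ 1` for `r ≥ 2`, and the packaging.  With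
`Scaling/ExtensiveActionInstances.lean` (`U1.extensive_action_R`) every hypothesis of (C2a-R) for
`Circle` is then available by name.  Elementary; nothing is cited as a fact.
-/

noncomputable section

open MeasureTheory Real Set Metric
open Literature.MathematicalPhysics.QuantumFieldTheory

namespace Summit.Ventures.LatticeQCDFlow.Theory2.Lattice.U1

/-! ## §1. Metric balls are chordal balls; translation invariance -/

/-- The metric of `Circle` is the chordal one: `dist z w = |z − w|` in `ℂ`. [folklore] -/
theorem dist_eq_norm_coe (z w : Circle) : dist z w = ‖(z : ℂ) - w‖ := by
  change dist (z : ℂ) (w : ℂ) = _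
  exact dist_eq_norm _ _

/-- `B̄(1, r) = {z : |z − 1| ≤ r}`. [folklore] -/
theorem closedBall_one_eq (r : ℝ) :
    closedBall (1 : Circle) r = {z : Circle | ‖(z : ℂ) - 1‖ ≤ r} := by
  ext z
  rw [mem_closedBall, dist_eq_norm_coe, Circle.coe_one, mem_setOf_eq]

/-- `arc r ⊆ B̄(1, r)` (`|e^{iθ} − 1| ≤ |θ|`, row 30's `SUNHaar.norm_sub_one_le_of_mem_arc`).
[folklore] -/
theorem arc_subset_closedBall {r : ℝ} : arc r ⊆ closedBall (1 : Circle) r := by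
  intro z hz
  rw [closedBall_one_eq, mem_setOf_eq]
  exact SUNHaar.norm_sub_one_le_of_mem_arc hz

/-- Balls about `g` are translates of balls about `1` (the chordal metric is invariant).
[folklore] -/
theorem closedBall_eq_preimage (g : Circle) (r : ℝ) :
    closedBall g r = (fun z => g⁻¹ * z) ⁻¹' closedBall (1 : Circle) r := by
  ext z
  simp only [Set.mem_preimage, mem_closedBall, dist_eq_norm_coe, Circle.coe_mul, Circle.coe_inv,
    Circle.coe_one]
  rw [show ((g : ℂ))⁻¹ * (z : ℂ) - 1 = ((g : ℂ))⁻¹ * ((z : ℂ) - g) by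
    rw [mul_sub, inv_mul_cancel₀ (Circle.coe_ne_zero g)], norm_mul, norm_inv, Circle.norm_coe,
    inv_one, one_mul]

/-- Haar volume of a ball is independent of its centre. [folklore] -/
theorem haar_closedBall_eq (g : Circle) (r : ℝ) :
    haarProbability Circle (closedBall g r) = haarProbability Circle (closedBall 1 r) := by
  unfold haarProbability
  rw [closedBall_eq_preimage]
  exact measure_preimage_mul _ _ _

/-- The Haar probability of any set is at most `1`. [folklore] -/
theorem haarProbability_le_one (s : Set Circle) : haarProbability Circle s ≤ 1 := by
  unfold haarProbability
  calc Measure.haarMeasure ⊤ s ≤ Measure.haarMeasure ⊤ (univ : Set Circle) :=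
        measure_mono (subset_univ s)
    _ = 1 := by
        rw [← TopologicalSpace.PositiveCompacts.coe_top]
        exact Measure.haarMeasure_self

/-! ## §2. Two-sided ball volumes (Ahlfors exponent `κ = 1`) -/

/-- **Lower ball volume**: `(1/π)·r ≤ Haar(B̄(g, r))` for `0 < r ≤ 1` (row 30's `haar_arc_ge`
and `arc r ⊆ B̄(1, r)`). [folklore] -/
theorem haar_closedBall_ge (g : Circle) {r : ℝ} (hr : 0 < r) (hr1 : r ≤ 1) :
    1 / π * r ^ 1 ≤ (haarProbability Circle (closedBall g r)).toReal := by
  rw [haar_closedBall_eq, pow_one]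
  have h := haar_arc_ge hr hr1
  rw [Real.rpow_one] at h
  refine h.trans (ENNReal.toReal_mono ?_ (measure_mono arc_subset_closedBall))
  exact ne_top_of_le_ne_top ENNReal.one_ne_top (haarProbability_le_one _)

/-- **Upper ball volume**: `Haar(B̄(g, r)) ≤ r/2` for `0 < r` (row 30's `SUNHaar.haar_chordBall_le`
for `r < 2`, total mass `1` otherwise). [folklore] -/
theorem haar_closedBall_le (g : Circle) {r : ℝ} (hr : 0 < r) :
    (haarProbability Circle (closedBall g r)).toReal ≤ 1 / 2 * r ^ 1 := by
  rw [haar_closedBall_eq, pow_one, closedBall_one_eq]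
  rcases lt_or_ge r 2 with h2 | h2
  · calc (haarProbability Circle {z : Circle | ‖(z : ℂ) - 1‖ ≤ r}).toReal ≤ r / 2 :=
          SUNHaar.haar_chordBall_le hr.le h2
      _ = 1 / 2 * r := by ring
  · calc (haarProbability Circle {z : Circle | ‖(z : ℂ) - 1‖ ≤ r}).toReal ≤ 1 :=
          ENNReal.toReal_le_of_le_ofReal zero_le_one
            (by rw [ENNReal.ofReal_one]; exact haarProbability_le_one _)
      _ ≤ 1 / 2 * r := by linarith

/-- Row 30's hypothesis `hlo` of `exactTransportBiLipschitz_of_ballVolumes` for `Circle`, `κ = 1`,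
`a = 1/π`. [folklore] -/
theorem haar_closedBall_ge' : ∃ a : ℝ, 0 < a ∧ ∀ (g : Circle) (r : ℝ), 0 < r → r ≤ 1 →
    a * r ^ 1 ≤ (haarProbability Circle (closedBall g r)).toReal :=
  ⟨1 / π, by positivity, fun g _ hr hr1 => haar_closedBall_ge g hr hr1⟩

/-- Row 30's hypothesis `hup` of `exactTransportBiLipschitz_of_ballVolumes` for `Circle`, `κ = 1`,
`A = 1/2`. [folklore] -/
theorem haar_closedBall_le' : ∃ A : ℝ, 0 < A ∧ ∀ (g : Circle) (r : ℝ), 0 < r →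
    (haarProbability Circle (closedBall g r)).toReal ≤ A * r ^ 1 :=
  ⟨1 / 2, by norm_num, fun g _ hr => haar_closedBall_le g hr⟩

end Summit.Ventures.LatticeQCDFlow.Theory2.Lattice.U1

end
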